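import Summits.CriticalPhenomena.PercolationContinuityZ3.Theorems.Transplant.Slab111HexShadow
import Summits.CriticalPhenomena.PercolationContinuityZ3.Theorems.Transplant.HexShadowVRouteData
import HarnessLib

/-!
# Paths in the `(111)`-films `F_k`, I: vertices by (column, rung), the three unit steps, face helices

builds on p205010 (kernel theorem, internal audit signed; external expert review pending) — NOT used in this file.  Lane `prim-bschramm`, seat
`prim-bschramm-p2` (gen 34; class C1b; memo `HOME/bschramm/P2-LATTICES.md` §127); helper file (`--supports stmt-CriticalPhenomena-4575 --as helper`).
Toolkit for the instance of `HexShadow.ShapedLinkage 3` on `Slab111.film k` («TriFilmPaths» §1 analogue).  A vertex of `F_k = {0 ≤ x₀+x₁+x₂ ≤ k}` is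
determined by its shadow `q = sh x = (x₀−x₂, x₂−x₁) ∈ 𝕋` and its RUNG `m = x₁`: `x = (m + q₀ + q₁, m, m + q₁)`, level `lev x = 3m + q₀ + 2q₁` (so the
column over `q` has one vertex at every third level, of residue `q₀ − q₁ (mod 3)`).  The film has NO vertical edges: the neighbours of `(q, m)` one
level up are `(q + (1,0), m)`, `(q + (0,−1), m+1)`, `(q + (−1,1), m)` (the shadow moves by `U = {(1,0), (0,−1), (−1,1)}`), one level down the reverses.
* §1 `Slab111.Rung k q m` (the rung is in range), **`Slab111.vx k q m`** (the vertex), `vx_coe`, `sh_vx`, `lev_vx`, `vx_inj`, `exists_eq_vx`;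
* §2 the three up-steps `adj_vx_u₁/u₂/u₃` and the characterisation `adj_vx_iff`;
* §3 every triangular face of `𝕋` is a HELIX of `F_k`: the up-cycle `q → q + (1,0) → q + (1,−1) → q` climbs three levels (`helix3`).
[cite: GrimmettPercolation1999, §1.6 p. 16] [cite: DuminilCopinSidoraviciusTassion2016, §2.3 (proof of Fact 2: the paths γ_u, γ_v, γ_w)]
-/

noncomputable section

namespace Summit.CriticalPhenomena.PercolationContinuityZ3.Theorems.Transplant

open Literature.Probability.Percolation Literature.Probability.LatticeModels SimpleGraph
open scoped Classical

namespace Slab111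

variable {k : ℕ}

/-! ## §1 Vertices by column and rung -/

/-- The rung `m` is in range over the column `q`: the level `3m + q₀ + 2q₁` lies in `[0, k]`. [folklore] -/
def Rung (k : ℕ) (q : Site 2) (m : ℤ) : Prop := 0 ≤ 3 * m + q 0 + 2 * q 1 ∧ 3 * m + q 0 + 2 * q 1 ≤ k

/-- The site `(m + q₀ + q₁, m, m + q₁)` of `ℤ³`: shadow `q`, rung `m`. [folklore] -/
def site (q : Site 2) (m : ℤ) : Site 3 := ![m + q 0 + q 1, m, m + q 1]

/-- The level of `site q m` is `3m + q₀ + 2q₁`. [folklore] -/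
theorem lev_site (q : Site 2) (m : ℤ) : lev (site q m) = 3 * m + q 0 + 2 * q 1 := by
  simp [lev, site]; ring

/-- `site q m` lies in the film iff the rung is in range. [folklore] -/
theorem site_mem_iff (q : Site 2) (m : ℤ) : site q m ∈ slab111 k ↔ Rung k q m := by
  rw [mem_slab111_iff_lev, lev_site]; rfl

/-- **The vertex of `F_k` over the column `q` at rung `m`** (a fixed junk vertex when the rung is out of range). [folklore] -/
def vx (k : ℕ) (q : Site 2) (m : ℤ) : slab111 k :=
  if h : Rung k q m then ⟨site q m, (site_mem_iff q m).2 h⟩ else ⟨![0, 0, 0], by rw [mem_slab111]; simp⟩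

/-- Coordinates of `vx`. [folklore] -/
theorem vx_coe {q : Site 2} {m : ℤ} (h : Rung k q m) : ((vx k q m : slab111 k) : Site 3) = ![m + q 0 + q 1, m, m + q 1] := by
  simp [vx, h, site]

/-- The shadow of `vx k q m` is `q`. [folklore] -/
@[simp] theorem sh_vx {q : Site 2} {m : ℤ} (h : Rung k q m) : sh (vx k q m) = q := by
  ext i; fin_cases i <;> simp [sh, vx_coe h]

/-- The level of `vx k q m` is `3m + q₀ + 2q₁`. [folklore] -/
theorem lev_vx {q : Site 2} {m : ℤ} (h : Rung k q m) : lev ((vx k q m : slab111 k) : Site 3) = 3 * m + q 0 + 2 * q 1 := by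
  rw [vx_coe h]; simp [lev]; ring

/-- The rung of `vx k q m` (its middle coordinate) is `m`. [folklore] -/
theorem vx_coe_one {q : Site 2} {m : ℤ} (h : Rung k q m) : ((vx k q m : slab111 k) : Site 3) 1 = m := by
  rw [vx_coe h]; simp

/-- `vx` is injective on rungs in range. [folklore] -/
theorem vx_inj {q q' : Site 2} {m m' : ℤ} (h : Rung k q m) (h' : Rung k q' m') : vx k q m = vx k q' m' ↔ q = q' ∧ m = m' := by
  constructor
  · intro heq
    have hs : sh (vx k q m) = sh (vx k q' m') := by rw [heq]
    rw [sh_vx h, sh_vx h'] at hs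
    have h1 : ((vx k q m : slab111 k) : Site 3) 1 = ((vx k q' m' : slab111 k) : Site 3) 1 := by rw [heq]
    rw [vx_coe_one h, vx_coe_one h'] at h1
    exact ⟨hs, h1⟩
  · rintro ⟨rfl, rfl⟩; rfl

/-- **Every vertex of the film is a `vx`**: column `sh x`, rung `x₁`. [folklore] -/
theorem exists_eq_vx (x : slab111 k) : ∃ (q : Site 2) (m : ℤ), Rung k q m ∧ x = vx k q m := by
  refine ⟨sh x, (x : Site 3) 1, ?_, ?_⟩
  · have hx := mem_slab111_iff_lev.1 x.2
    simp only [Rung, sh_apply_zero, sh_apply_one, lev] at hx ⊢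
    omega
  · have hR : Rung k (sh x) ((x : Site 3) 1) := by
      have hx := mem_slab111_iff_lev.1 x.2
      simp only [Rung, sh_apply_zero, sh_apply_one, lev] at hx ⊢
      omega
    apply Subtype.ext
    rw [vx_coe hR]
    ext i; fin_cases i
    · simp; omega
    · simp
    · simp

/-! ## §2 The three unit steps -/

/-- The up-step directions of the shadow: `u₁ = (1,0)`, `u₂ = (0,−1)`, `u₃ = (−1,1)`. [folklore] -/
def u₁ : Site 2 := ![1, 0]
/-- The up-step direction `u₂ = (0,−1)`. [folklore] -/
def u₂ : Site 2 := ![0, -1]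
/-- The up-step direction `u₃ = (−1,1)`. [folklore] -/
def u₃ : Site 2 := ![-1, 1]

/-- Coordinate `u₁ 0 = 1`. [folklore] -/
@[simp] theorem u₁_zero : u₁ 0 = 1 := rfl
/-- Coordinate `u₁ 1 = 0`. [folklore] -/
@[simp] theorem u₁_one : u₁ 1 = 0 := rfl
/-- Coordinate `u₂ 0 = 0`. [folklore] -/
@[simp] theorem u₂_zero : u₂ 0 = 0 := rfl
/-- Coordinate `u₂ 1 = −1`. [folklore] -/
@[simp] theorem u₂_one : u₂ 1 = -1 := rfl
/-- Coordinate `u₃ 0 = −1`. [folklore] -/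
@[simp] theorem u₃_zero : u₃ 0 = -1 := rfl
/-- Coordinate `u₃ 1 = 1`. [folklore] -/
@[simp] theorem u₃_one : u₃ 1 = 1 := rfl

/-- Adjacency of two `vx` from their coordinates: they differ by a unit coordinate vector of `ℤ³`. [folklore] -/
theorem adj_vx_of_coe {q q' : Site 2} {m m' : ℤ} (i : Fin 3)
    (hc : ((vx k q' m' : slab111 k) : Site 3) = ((vx k q m : slab111 k) : Site 3) + Pi.single i 1) : (film k).Adj (vx k q m) (vx k q' m') := by
  change (zdGraph 3).Adj _ _
  rw [zdGraph_adj_iff]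
  exact ⟨i, Or.inl hc⟩

/-- **Up-step `u₁`**: `(q, m) ∼ (q + (1,0), m)` (the `ℤ³`-edge `+e₀`). [folklore] -/
theorem adj_vx_u₁ {q : Site 2} {m : ℤ} (h : Rung k q m) (h' : Rung k (q + u₁) m) : (film k).Adj (vx k q m) (vx k (q + u₁) m) := by
  refine adj_vx_of_coe 0 ?_
  rw [vx_coe h, vx_coe h']
  ext i; fin_cases i
  · simp; omega
  · simp
  · simp

/-- **Up-step `u₂`**: `(q, m) ∼ (q + (0,−1), m + 1)` (the `ℤ³`-edge `+e₁`). [folklore] -/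
theorem adj_vx_u₂ {q : Site 2} {m : ℤ} (h : Rung k q m) (h' : Rung k (q + u₂) (m + 1)) : (film k).Adj (vx k q m) (vx k (q + u₂) (m + 1)) := by
  refine adj_vx_of_coe 1 ?_
  rw [vx_coe h, vx_coe h']
  ext i; fin_cases i
  · simp; omega
  · simp
  · simp; omega

/-- **Up-step `u₃`**: `(q, m) ∼ (q + (−1,1), m)` (the `ℤ³`-edge `+e₂`). [folklore] -/
theorem adj_vx_u₃ {q : Site 2} {m : ℤ} (h : Rung k q m) (h' : Rung k (q + u₃) m) : (film k).Adj (vx k q m) (vx k (q + u₃) m) := by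
  refine adj_vx_of_coe 2 ?_
  rw [vx_coe h, vx_coe h']
  ext i; fin_cases i
  · simp; omega
  · simp
  · simp; omega

/-- **Adjacency of two film vertices in (column, rung) coordinates**: an up-step or a down-step along `U`. [folklore] -/
theorem adj_vx_iff {q q' : Site 2} {m m' : ℤ} (h : Rung k q m) (h' : Rung k q' m') :
    (film k).Adj (vx k q m) (vx k q' m') ↔
      ((q' = q + u₁ ∧ m' = m) ∨ (q' = q + u₂ ∧ m' = m + 1) ∨ (q' = q + u₃ ∧ m' = m)) ∨
        ((q = q' + u₁ ∧ m = m') ∨ (q = q' + u₂ ∧ m = m' + 1) ∨ (q = q' + u₃ ∧ m = m')) := by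
  constructor
  · intro hadj
    have hz : (zdGraph 3).Adj ((vx k q m : slab111 k) : Site 3) ((vx k q' m' : slab111 k) : Site 3) := hadj
    obtain ⟨i, hi | hi⟩ := (zdGraph_adj_iff _ _).1 hz
    · left
      have h0 := congrFun hi 0; have h1 := congrFun hi 1; have h2 := congrFun hi 2
      rw [vx_coe h, vx_coe h'] at h0 h1 h2
      fin_cases i <;> simp at h0 h1 h2
      · left; refine ⟨?_, by omega⟩; ext j; fin_cases j <;> simp <;> omega
      · right; left; refine ⟨?_, by omega⟩; ext j; fin_cases j <;> simp <;> omega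
      · right; right; refine ⟨?_, by omega⟩; ext j; fin_cases j <;> simp <;> omega
    · right
      have h0 := congrFun hi 0; have h1 := congrFun hi 1; have h2 := congrFun hi 2
      rw [vx_coe h, vx_coe h'] at h0 h1 h2
      fin_cases i <;> simp at h0 h1 h2
      · left; refine ⟨?_, by omega⟩; ext j; fin_cases j <;> simp <;> omega
      · right; left; refine ⟨?_, by omega⟩; ext j; fin_cases j <;> simp <;> omega
      · right; right; refine ⟨?_, by omega⟩; ext j; fin_cases j <;> simp <;> omega
  · rintro (⟨⟨rfl, rfl⟩ | ⟨rfl, rfl⟩ | ⟨rfl, rfl⟩⟩ | ⟨⟨rfl, rfl⟩ | ⟨rfl, rfl⟩ | ⟨rfl, rfl⟩⟩)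
    · exact adj_vx_u₁ h h'
    · exact adj_vx_u₂ h h'
    · exact adj_vx_u₃ h h'
    · exact (adj_vx_u₁ h' h).symm
    · exact (adj_vx_u₂ h' h).symm
    · exact (adj_vx_u₃ h' h).symm

/-! ## §3 Face helices -/

/-- **Three up-steps around a face return to the column three levels higher**: `(q,m) → (q+u₁,m) → (q+u₁+u₂, m+1) → (q, m+1)` — note
`u₁ + u₂ + u₃ = 0`, and rung `m+1` over `q` is level `+3`. [folklore] -/
theorem adj_vx_face₃ {q : Site 2} {m : ℤ} (h : Rung k (q + u₁ + u₂) (m + 1)) (h' : Rung k q (m + 1)) :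
    (film k).Adj (vx k (q + u₁ + u₂) (m + 1)) (vx k q (m + 1)) := by
  have : q = q + u₁ + u₂ + u₃ := by ext i; fin_cases i <;> simp
  conv_rhs => rw [this]
  exact adj_vx_u₃ h (this ▸ h')

end Slab111

end Summit.CriticalPhenomena.PercolationContinuityZ3.Theorems.Transplant

end
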